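import Summits.CriticalPhenomena.CardyFormulaZ2.Theorems.HalfPlaneMarkDensityLaw.Negative.MarkEvents
import Literature.Probability.Percolation.PlanarDuality
import Literature.Probability.Percolation.RSWProofs
import Literature.Probability.Percolation.BoxCrossingUpperBound

/-!
# Line `Sketch`, wave 2 (the macroscopic window lower bound), W1: a dual "U" is one moat-to-moat dual walk

Support file for the crux `HalfPlaneMarkDensityLaw` (stmt-CriticalPhenomena-5661), line `Sketch`,
stub `stub_dualU_walk` of the lead's wave-2 skeleton (deterministic, dual side).

In the tree's dual coordinates (`dualConfig`, faces of `ℤ²` indexed by lower-left corners,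
`Crossings.lean`), a dual "U" consists of a dual-open top–bottom crossing `L` of the face box
`[g₁,g₂]×[-1,H]` (from the moat row `{z₁ = -1}` to the row `{z₁ = H}`), a dual-open left–right
crossing `B` of the bar `[g₁,r₂]×[H',H]` and a dual-open top–bottom crossing `R` of `[r₁,r₂]×[-1,H]`.
We glue them into ONE dual-open face walk from a moat face `(p₁,-1)`, `p₁ ∈ [g₁,g₂]`, to a moat face
`(p₂,-1)`, `p₂ ∈ [r₁,r₂]`, through faces of height `≥ -1`, that never runs along the moat (every edge
has an endpoint of height `≥ 0`):

* `exists_walk_firstRow`: the initial segment of a lattice walk up to its first visit of a row `a`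
  from above stays in the rows `≥ a` and each of its edges has an endpoint of height `> a`
  (row analogue of `exists_openConnIn_column_ge`, stated for walks);
* `leg_meets_bar`: a leg, followed downwards from its top end, is cut at its first visit of the moat
  row; its part above the row `H'` is a bottom–top crossing of the bar box, hence meets the bar
  (`exists_mem_support_of_crossing`);
* `stub_dualU_walk`: left leg up to the bar, along the bar, down the right leg.
-/

noncomputable section

namespace Summit.CriticalPhenomena.CardyFormulaZ2.Cruxes.HalfPlaneMarkDensityLaw.SketchLine

open Literature.Probability.Percolation Literature.Probability.LatticeModels
open MeasureTheory Filter Set SimpleGraph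
open scoped Topology
open Summit.CriticalPhenomena.CardyFormulaZ2.Theorems.HalfPlaneMarkDensityLaw.Negative

namespace Window

/-- **First visit of a row from above.** A lattice walk of `ℤ²` from `u` with `a ≤ u₁` to `v` with
`v₁ ≤ a` has an initial segment ending on the row `{z₁ = a}` all of whose vertices have height `≥ a`
and all of whose edges have an endpoint of height `> a` (cut at the first visit of the row `a`; a
lattice step changes the height by at most one). [folklore] -/
theorem exists_walk_firstRow {u v : Site 2} (p : (zdGraph 2).Walk u v) (a : ℤ) :
    a ≤ u 1 → v 1 ≤ a →
      ∃ (z : Site 2) (q : (zdGraph 2).Walk u z), z 1 = a ∧ (∀ w ∈ q.support, w ∈ p.support) ∧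
        (∀ e ∈ q.edges, e ∈ p.edges) ∧ (∀ w ∈ q.support, a ≤ w 1) ∧
        (∀ e ∈ q.edges, ∃ w ∈ e, a < w 1) := by
  induction p with
  | nil =>
    intro hu hv
    rename_i u
    refine ⟨u, Walk.nil, le_antisymm hv hu, fun w hw ↦ hw, fun e he ↦ he, fun w hw ↦ ?_,
      fun e he ↦ ?_⟩
    · rw [Walk.support_nil, List.mem_singleton] at hw
      rw [hw]; exact hu
    · simp at he
  | cons hadj p ih =>
    intro hu hv
    rename_i u w v
    rcases hu.eq_or_lt with hua | hua
    · refine ⟨u, Walk.nil, hua.symm, fun w' hw' ↦ ?_, fun e he ↦ ?_, fun w' hw' ↦ ?_,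
        fun e he ↦ ?_⟩
      · rw [Walk.support_nil, List.mem_singleton] at hw'
        rw [hw']; exact Walk.start_mem_support _
      · simp at he
      · rw [Walk.support_nil, List.mem_singleton] at hw'
        rw [hw']; exact hu
      · simp at he
    · have hw : a ≤ w 1 := by
        have := (zdGraph_adj_apply_le hadj 1).2
        omega
      obtain ⟨z, q, hz, hsupp, hedges, hrows, hend⟩ := ih hw hv
      refine ⟨z, Walk.cons hadj q, hz, fun w' hw' ↦ ?_, fun e he ↦ ?_, fun w' hw' ↦ ?_,
        fun e he ↦ ?_⟩
      · rw [Walk.support_cons, List.mem_cons] at hw' ⊢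
        rcases hw' with hw' | hw'
        · exact Or.inl hw'
        · exact Or.inr (hsupp _ hw')
      · rw [Walk.edges_cons, List.mem_cons] at he ⊢
        rcases he with he | he
        · exact Or.inl he
        · exact Or.inr (hedges _ he)
      · rw [Walk.support_cons, List.mem_cons] at hw'
        rcases hw' with rfl | hw'
        · exact hu
        · exact hrows _ hw'
      · rw [Walk.edges_cons, List.mem_cons] at he
        rcases he with rfl | he
        · exact ⟨u, Sym2.mem_mk_left _ _, hua⟩
        · exact hend _ he

/-- **A leg of the U meets the bar.** A dual-open top–bottom crossing of the face box
`[c₁,c₂]×[-1,H]` from the moat row to the row `H`, with `[c₁,c₂] ⊆ [g₁,r₂]`, and a lattice walk `Wb`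
inside the bar `[g₁,r₂]×[H',H]` (`0 ≤ H' ≤ H`) from the column `g₁` to the column `r₂` give a
dual-open face walk from a moat face `(p,-1)`, `p ∈ [c₁,c₂]`, to a vertex of `Wb`, through faces of
height `≥ -1`, each of whose edges has an endpoint of height `≥ 0`. [folklore] -/
theorem leg_meets_bar {ω : BondConfig (Site 2)} {c₁ c₂ g₁ r₂ H' H : ℤ} (hc₁ : g₁ ≤ c₁)
    (hc₂ : c₂ ≤ r₂) (hH' : 0 ≤ H') (hH'H : H' ≤ H)
    (hleg : dualConfig ω ∈ openCrossing {z : Site 2 | c₁ ≤ z 0 ∧ z 0 ≤ c₂ ∧ -1 ≤ z 1 ∧ z 1 ≤ H}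
      {z : Site 2 | z 1 = -1} {z : Site 2 | z 1 = H})
    {xl xr : Site 2} (Wb : (zdGraph 2).Walk xl xr) (hxl : xl 0 = g₁) (hxr : xr 0 = r₂)
    (hWb : ∀ z ∈ Wb.support, g₁ ≤ z 0 ∧ z 0 ≤ r₂ ∧ H' ≤ z 1 ∧ z 1 ≤ H) :
    ∃ (p : ℤ) (m : Site 2) (q : (zdGraph 2).Walk (![p, -1] : Site 2) m),
      c₁ ≤ p ∧ p ≤ c₂ ∧ m ∈ Wb.support ∧ (∀ e ∈ q.edges, e ∈ dualConfig ω) ∧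
      (∀ z ∈ q.support, -1 ≤ z 1) ∧ (∀ e ∈ q.edges, ∃ w ∈ e, (0 : ℤ) ≤ w 1) := by
  obtain ⟨xb, hxb, zt, hzt, hconn⟩ := hleg
  rw [mem_setOf_eq] at hxb hzt
  obtain ⟨W, hWS, hWω⟩ :=
    exists_walk_of_mem_openConnIn (G := zdGraph 2) (dualConfig_subset_edgeSet ω) hconn
  have hWbox : ∀ z ∈ W.reverse.support, c₁ ≤ z 0 ∧ z 0 ≤ c₂ ∧ -1 ≤ z 1 ∧ z 1 ≤ H := by
    intro z hz
    rw [Walk.support_reverse, List.mem_reverse] at hz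
    exact hWS z hz
  have hWω' : ∀ e ∈ W.reverse.edges, e ∈ dualConfig ω := by
    intro e he
    rw [Walk.edges_reverse, List.mem_reverse] at he
    exact hWω e he
  -- cut the leg, followed downwards from its top end `zt`, at its first visit of the moat row
  obtain ⟨z₁, q₁, hz₁, hq₁supp, hq₁edges, -, hq₁end⟩ :=
    exists_walk_firstRow W.reverse (-1) (by omega) hxb.le
  -- its part above the row `H'` is a top–bottom crossing of the bar box, hence meets the bar
  obtain ⟨z₂, q₂, hz₂, hq₂supp, -, hq₂rows, -⟩ := exists_walk_firstRow q₁ H' (by omega) (by omega)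
  have hq₂box : ∀ z ∈ q₂.reverse.support, g₁ ≤ z 0 ∧ z 0 ≤ r₂ ∧ H' ≤ z 1 ∧ z 1 ≤ H := by
    intro z hz
    rw [Walk.support_reverse, List.mem_reverse] at hz
    have h₁ := hWbox z (hq₁supp z (hq₂supp z hz))
    have h₂ := hq₂rows z hz
    omega
  obtain ⟨m, hmWb, hmq₂⟩ := exists_mem_support_of_crossing (L := g₁) (R := r₂) (B := H') (T := H)
    Wb q₂.reverse hWb hq₂box hxl hxr hz₂ hzt
  rw [Walk.support_reverse, List.mem_reverse] at hmq₂
  have hmq₁ : m ∈ q₁.support := hq₂supp m hmq₂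
  have hz₁eq : z₁ = ![z₁ 0, -1] := by
    rw [Site.eq_iff_two]; simp [hz₁]
  refine ⟨z₁ 0, m, (q₁.dropUntil m hmq₁).reverse.copy hz₁eq rfl, ?_, ?_, hmWb, ?_, ?_, ?_⟩
  · exact (hWbox z₁ (hq₁supp z₁ q₁.end_mem_support)).1
  · exact (hWbox z₁ (hq₁supp z₁ q₁.end_mem_support)).2.1
  · intro e he
    rw [Walk.edges_copy, Walk.edges_reverse, List.mem_reverse] at he
    exact hWω' e (hq₁edges e (q₁.edges_dropUntil_subset_edges hmq₁ he))
  · intro z hz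
    rw [Walk.support_copy, Walk.support_reverse, List.mem_reverse] at hz
    exact (hWbox z (hq₁supp z (q₁.support_dropUntil_subset_support hmq₁ hz))).2.2.1
  · intro e he
    rw [Walk.edges_copy, Walk.edges_reverse, List.mem_reverse] at he
    obtain ⟨w, hw, hw1⟩ := hq₁end e (q₁.edges_dropUntil_subset_edges hmq₁ he)
    exact ⟨w, hw, by omega⟩

/-- STUB W1 (deterministic, dual side): a dual U gives a dual face walk from the moat under the left box
to the moat under the right box, all of whose edges have an endpoint of height `≥ 0`. [folklore] -/
theorem stub_dualU_walk :
    ∀ (ω : BondConfig (Site 2)) (g₁ g₂ r₁ r₂ H' H : ℤ), g₁ ≤ g₂ → g₂ < r₁ → r₁ ≤ r₂ → 0 ≤ H' → H' ≤ H →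
      dualConfig ω ∈ openCrossing {z : Site 2 | g₁ ≤ z 0 ∧ z 0 ≤ g₂ ∧ -1 ≤ z 1 ∧ z 1 ≤ H}
        {z : Site 2 | z 1 = -1} {z : Site 2 | z 1 = H} →
      dualConfig ω ∈ openCrossing {z : Site 2 | g₁ ≤ z 0 ∧ z 0 ≤ r₂ ∧ H' ≤ z 1 ∧ z 1 ≤ H}
        {z : Site 2 | z 0 = g₁} {z : Site 2 | z 0 = r₂} →
      dualConfig ω ∈ openCrossing {z : Site 2 | r₁ ≤ z 0 ∧ z 0 ≤ r₂ ∧ -1 ≤ z 1 ∧ z 1 ≤ H}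
        {z : Site 2 | z 1 = -1} {z : Site 2 | z 1 = H} →
      ∃ p₁ p₂ : ℤ, g₁ ≤ p₁ ∧ p₁ ≤ g₂ ∧ r₁ ≤ p₂ ∧ p₂ ≤ r₂ ∧
        ∃ Q : (zdGraph 2).Walk (![p₁, -1] : Site 2) ![p₂, -1],
          (∀ e ∈ Q.edges, e ∈ dualConfig ω) ∧ (∀ z ∈ Q.support, -1 ≤ z 1) ∧
          (∀ e ∈ Q.edges, ∃ w ∈ e, (0 : ℤ) ≤ w 1) := by
  intro ω g₁ g₂ r₁ r₂ H' H h₁₂ h₂r hr₁₂ hH' hH'H hL hB hR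
  classical
  -- the bar
  obtain ⟨xl, hxl, xr, hxr, hbar⟩ := hB
  rw [mem_setOf_eq] at hxl hxr
  obtain ⟨Wb, hWbS, hWbω⟩ :=
    exists_walk_of_mem_openConnIn (G := zdGraph 2) (dualConfig_subset_edgeSet ω) hbar
  have hWb : ∀ z ∈ Wb.support, g₁ ≤ z 0 ∧ z 0 ≤ r₂ ∧ H' ≤ z 1 ∧ z 1 ≤ H := fun z hz ↦ hWbS z hz
  -- the two legs, each up to a vertex of the bar
  obtain ⟨p₁, m₁, q₁, hp₁, hp₁', hm₁, hq₁ω, hq₁supp, hq₁end⟩ :=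
    leg_meets_bar le_rfl (by omega) hH' hH'H hL Wb hxl hxr hWb
  obtain ⟨p₂, m₂, q₂, hp₂, hp₂', hm₂, hq₂ω, hq₂supp, hq₂end⟩ :=
    leg_meets_bar (by omega) le_rfl hH' hH'H hR Wb hxl hxr hWb
  -- along the bar from `m₁` to `m₂` (back to `xl`, then forward)
  set seg : (zdGraph 2).Walk m₁ m₂ := (Wb.takeUntil m₁ hm₁).reverse.append (Wb.takeUntil m₂ hm₂)
    with hseg
  have hsegE : ∀ e ∈ seg.edges, e ∈ Wb.edges := by
    intro e he
    rw [hseg, Walk.edges_append, List.mem_append, Walk.edges_reverse, List.mem_reverse] at he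
    rcases he with he | he
    · exact Wb.edges_takeUntil_subset_edges hm₁ he
    · exact Wb.edges_takeUntil_subset_edges hm₂ he
  have hsegS : ∀ z ∈ seg.support, z ∈ Wb.support := by
    intro z hz
    rw [hseg, Walk.mem_support_append_iff, Walk.support_reverse, List.mem_reverse] at hz
    rcases hz with hz | hz
    · exact Wb.support_takeUntil_subset_support hm₁ hz
    · exact Wb.support_takeUntil_subset_support hm₂ hz
  refine ⟨p₁, p₂, hp₁, hp₁', hp₂, hp₂', q₁.append (seg.append q₂.reverse), ?_, ?_, ?_⟩
  · intro e he
    rw [Walk.edges_append, List.mem_append, Walk.edges_append, List.mem_append, Walk.edges_reverse,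
      List.mem_reverse] at he
    rcases he with he | he | he
    · exact hq₁ω e he
    · exact hWbω e (hsegE e he)
    · exact hq₂ω e he
  · intro z hz
    rw [Walk.mem_support_append_iff, Walk.mem_support_append_iff, Walk.support_reverse,
      List.mem_reverse] at hz
    rcases hz with hz | hz | hz
    · exact hq₁supp z hz
    · have := (hWb z (hsegS z hz)).2.2.1; omega
    · exact hq₂supp z hz
  · intro e he
    rw [Walk.edges_append, List.mem_append, Walk.edges_append, List.mem_append, Walk.edges_reverse,
      List.mem_reverse] at he
    rcases he with he | he | he
    · exact hq₁end e he
    · refine ⟨e.out.1, Sym2.out_fst_mem e, ?_⟩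
      have := (hWb _ (hsegS _ (Walk.mem_support_of_mem_edges he (Sym2.out_fst_mem e)))).2.2.1
      omega
    · exact hq₂end e he

end Window

end Summit.CriticalPhenomena.CardyFormulaZ2.Cruxes.HalfPlaneMarkDensityLaw.SketchLine
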